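import Literature.NumberTheory.PAdicHodge.BdRPlusLatticeSeparated
import HarnessLib

/-!
# `B_dR⁺/Fil^k` is COMPLETE for Fontaine's `p`-adic topology: lattice-Cauchy sequences converge modulo `ξ^k`

Topic `Literature/NumberTheory/PAdicHodge`; namespace `Literature.NumberTheory.PAdicHodge.GaloisContinuity`. THEOREMS ONLY
(no definition, no named fact, no instance, no `sorry`). Sequel of `BdRPlusGaloisContinuity` (the lattices
`Λ(N, k) = p^N ι(𝔸_inf) + ξ^k B_dR⁺`, unit balls of the `ℚ_p`-Banach spaces `B_dR⁺/Fil^k = (𝔸_inf/ξ^k)[1/p]`; boundedness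
`p^r b ∈ ι(𝔸_inf) + ξ^k B_dR⁺`) and `BdRPlusLatticeSeparated` (`⋂_N Λ(N,k) = ξ^k B_dR⁺`). Those files give «Hausdorff»; this one
gives «complete»:

* ★ `exists_lim_of_forall_sub_mem_lattice` — if `x : ℕ → B_dR⁺` has `x(N+1) − x(N) ∈ Λ(N, k)` for all `N`, there is `L ∈ B_dR⁺` with
  `L − x(M) ∈ Λ(N, k)` for all `M ≥ N + r` (some `r`, the bound of `x 0`): the sequence CONVERGES to `L` modulo `Fil^k` for Fontaine's
  topology. Proof: `p^r x(N) = ι(A_N) + ξ^k W_N` with `A_{N+1} − A_N ∈ p^{N+r}𝔸_inf` (telescoping the hypothesis), `A_N → A_∞`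
  `p`-adically in `𝔸_inf = 𝕎(𝒪♭)` (Mathlib: `p`-adically complete), `L := p^{-r}(ι(A_∞) + ξ^k W_0)`.
* `sub_mem_span_xiBdR_pow_of_forall_lattice_lim` — such a limit is UNIQUE modulo `ξ^k B_dR⁺` (from `⋂_N Λ(N,k) = ξ^k B_dR⁺`).

This is the «(p, ξ)-adic evaluation layer» on `B_dR⁺/Fil^k` that every `p`-adic limit construction inside `B_dR⁺` needs — e.g.
Fontaine's `log[x]` for `x ∈ 1 + 𝔪_{ℂ♭}` (which does NOT converge `ξ`-adically when `x♯ ≠ 1`), hence the `ℚ_p(1)`-structure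
`X₂ = ℚ_p·log[1 + 𝔪♭] ⊂ B_dR⁺/Fil²` of floor (H4) of `Summits/…/Cruxes/StarredOptimalManinUnitFiveSeven/Lines/kato-lever-K3-B2-road.md`
(crux K★ `stmt-BirchSwinnertonDyer-22226`). Infrastructure only; BSD / K★ are not proved by any of this.

## References
* J.-M. Fontaine, *Le corps des périodes p-adiques*, Astérisque 223 (1994), Exp. II §1.5.3 (`B_dR⁺/Fil^k B_dR⁺` is a `p`-adic Banach
  space with unit ball the image of `A_inf`). [FontaineAsterisque223III]
* J.-M. Fontaine, Y. Ouyang, *Theory of p-adic Galois representations*, Prop. 4.4.3, §5.2. [FontaineOuyang2022]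
* K. Kato, LNM 1553 (1993), Ch. II §1.2.5. [Kato1993LNM1553]
-/

noncomputable section

open ValuativeRel Field Ideal WittVector

namespace Literature.NumberTheory.PAdicHodge

namespace GaloisContinuity

open Literature.NumberTheory.GaloisRepresentations
open Literature.NumberTheory.GaloisRepresentations.IsNonarchimedeanLocalField

variable {F : Type} [Field F] [ValuativeRel F] [TopologicalSpace F] [IsNonarchimedeanLocalField F]
  [CharZero F] {p : ℕ} [Fact p.Prime] [Fact (¬ IsUnit (p : integerC F))]
  [IsAdicComplete (Ideal.span {(p : integerC F)}) (integerC F)]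

omit [CharZero F] in
/-- **Integral coordinates of a lattice-Cauchy sequence.** If `p^r x(0) = ι(a₀) + ξ^k w₀` and `x(N+1) − x(N) = ι(p^N a_N) + ξ^k w_N`
for all `N`, then `p^r x(N) = ι(A N) + ξ^k (W N)` with `A (N+1) − A N = p^{N+r} a_N` (telescoping).
[cite: FontaineAsterisque223III, Exp. II §1.5.3] -/
theorem exists_coords_of_forall_sub_eq {x : ℕ → BDeRhamPlus (integerC F) p} {k r : ℕ} {a₀ : Ainf (p := p) F}
    {w₀ : BDeRhamPlus (integerC F) p} (h₀ : (p : BDeRhamPlus (integerC F) p) ^ r * x 0 = ainfToBdR a₀ + xiBdR ^ k * w₀)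
    (a : ℕ → Ainf (p := p) F) (w : ℕ → BDeRhamPlus (integerC F) p)
    (hx : ∀ N, x (N + 1) - x N = ainfToBdR ((p : Ainf (p := p) F) ^ N * a N) + xiBdR ^ k * w N) :
    ∃ (A : ℕ → Ainf (p := p) F) (W : ℕ → BDeRhamPlus (integerC F) p),
      (∀ N, (p : BDeRhamPlus (integerC F) p) ^ r * x N = ainfToBdR (A N) + xiBdR ^ k * W N) ∧
      (∀ N, A (N + 1) - A N = (p : Ainf (p := p) F) ^ (N + r) * a N) ∧ A 0 = a₀ ∧ W 0 = w₀ := by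
  -- recursive coordinates
  let A : ℕ → Ainf (p := p) F := fun N => Nat.rec a₀ (fun n acc => acc + (p : Ainf (p := p) F) ^ (n + r) * a n) N
  let W : ℕ → BDeRhamPlus (integerC F) p :=
    fun N => Nat.rec w₀ (fun n acc => acc + (p : BDeRhamPlus (integerC F) p) ^ r * w n) N
  have hA : ∀ N, A (N + 1) = A N + (p : Ainf (p := p) F) ^ (N + r) * a N := fun N => rfl
  have hW : ∀ N, W (N + 1) = W N + (p : BDeRhamPlus (integerC F) p) ^ r * w N := fun N => rfl
  refine ⟨A, W, fun N => ?_, fun N => by rw [hA]; ring, rfl, rfl⟩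
  induction N with
  | zero => exact h₀
  | succ N ih =>
    have e : x (N + 1) = x N + (x (N + 1) - x N) := by ring
    rw [e, mul_add, ih, hx N, hA, hW]
    simp only [map_add, map_mul, map_pow, map_natCast]
    ring

omit [CharZero F] [IsAdicComplete (Ideal.span {(p : integerC F)}) (integerC F)] in
/-- **`p`-adic limits in `𝔸_inf` in membership form**: a sequence `A` with `A(N+1) − A(N) ∈ p^N 𝔸_inf` has a `p`-adic limit `A_∞`
with `A_∞ − A(N) ∈ p^N 𝔸_inf` (Mathlib: `𝕎(𝒪♭)` is `p`-adically complete). [cite: FontaineOuyang2022, Prop. 4.4.3] -/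
theorem exists_padic_lim_ainf {A : ℕ → Ainf (p := p) F}
    (hA : ∀ N, A (N + 1) - A N ∈ Ideal.span {((p : Ainf (p := p) F)) ^ N}) :
    ∃ L : Ainf (p := p) F, ∀ N, L - A N ∈ Ideal.span {((p : Ainf (p := p) F)) ^ N} := by
  have htel : ∀ {m n : ℕ}, m ≤ n → A n - A m ∈ Ideal.span {((p : Ainf (p := p) F)) ^ m} := by
    intro m n hmn
    induction n, hmn using Nat.le_induction with
    | base => rw [sub_self]; exact Submodule.zero_mem _
    | succ n hmn ih =>
      have e : A (n + 1) - A m = (A (n + 1) - A n) + (A n - A m) := by ring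
      rw [e]
      exact add_mem (Ideal.span_singleton_le_span_singleton.2 (pow_dvd_pow _ hmn) (hA n)) ih
  have hcauchy : ∀ {m n : ℕ}, m ≤ n → A m ≡ A n [SMOD (Ideal.span {(p : Ainf (p := p) F)} ^ m • ⊤ :
      Submodule (Ainf (p := p) F) (Ainf (p := p) F))] := by
    intro m n hmn
    rw [smul_eq_mul, Ideal.mul_top, Ideal.span_singleton_pow, SModEq.sub_mem, ← neg_sub]
    exact neg_mem (htel hmn)
  obtain ⟨L, hL⟩ := IsPrecomplete.prec (IsAdicComplete.toIsPrecomplete (I := Ideal.span {(p : Ainf (p := p) F)})) hcauchy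
  refine ⟨L, fun N => ?_⟩
  have hN := hL N
  rw [smul_eq_mul, Ideal.mul_top, Ideal.span_singleton_pow, SModEq.sub_mem] at hN
  rw [← neg_sub]
  exact neg_mem hN

/-- ★ **Completeness of `B_dR⁺/Fil^k` for Fontaine's topology.** If `x : ℕ → B_dR⁺(F)` is lattice-Cauchy in the sense
`x(N+1) − x(N) ∈ Λ(N, k) = p^N ι(𝔸_inf) + ξ^k B_dR⁺` for every `N`, then there are `L ∈ B_dR⁺` and `r ∈ ℕ` with
`L − x(M) ∈ Λ(N, k)` whenever `N + r ≤ M`: `x(M) → L` modulo `Fil^k`, at the rate of the hypothesis up to the shift `r`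
(the `p`-adic bound of `x(0)`). [cite: FontaineAsterisque223III, Exp. II §1.5.3] [cite: FontaineOuyang2022, Prop. 4.4.3] -/
theorem exists_lim_of_forall_sub_mem_lattice {x : ℕ → BDeRhamPlus (integerC F) p} {k : ℕ}
    (hx : ∀ N, ∃ (a : Ainf (p := p) F) (w : BDeRhamPlus (integerC F) p),
      x (N + 1) - x N = ainfToBdR ((p : Ainf (p := p) F) ^ N * a) + xiBdR ^ k * w) :
    ∃ (L : BDeRhamPlus (integerC F) p) (r : ℕ), ∀ N M : ℕ, N + r ≤ M →
      ∃ (a : Ainf (p := p) F) (w : BDeRhamPlus (integerC F) p),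
        L - x M = ainfToBdR ((p : Ainf (p := p) F) ^ N * a) + xiBdR ^ k * w := by
  choose a w hxaw using hx
  obtain ⟨r, a₀, w₀, h₀⟩ := exists_natCast_pow_mul_eq_ainfToBdR_add (x 0) k
  obtain ⟨A, W, hAW, hA, hA0, hW0⟩ := exists_coords_of_forall_sub_eq h₀ a w hxaw
  -- the integral coordinates converge `p`-adically
  obtain ⟨Ainf_, hlim⟩ := exists_padic_lim_ainf (A := A) (fun N => by
    rw [hA N, pow_add, mul_assoc]
    exact Ideal.mul_mem_right _ _ (Ideal.mem_span_singleton_self _))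
  -- `p^r` is a unit of `B_dR⁺`
  obtain ⟨u, hu⟩ : ∃ u : BDeRhamPlus (integerC F) p, (p : BDeRhamPlus (integerC F) p) ^ r * u = 1 := by
    obtain ⟨v, hv⟩ := (isUnit_natCast_bDeRhamPlus (F := F) (p := p) (Fact.out : p.Prime).ne_zero).pow r
    exact ⟨↑v⁻¹, by rw [← hv, Units.mul_inv]⟩
  refine ⟨u * (ainfToBdR Ainf_ + xiBdR ^ k * w₀), r, fun N M hM => ?_⟩
  obtain ⟨e, he⟩ := Ideal.mem_span_singleton'.1 (hlim M)
  obtain ⟨j, rfl⟩ := Nat.exists_eq_add_of_le hM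
  -- `L - x M = u (ι(A_∞ - A_M) + ξ^k (w₀ - W_M)) = ι(p^{N+j} e) + ξ^k u (w₀ - W_M)`
  refine ⟨(p : Ainf (p := p) F) ^ j * e, u * (w₀ - W (N + r + j)), ?_⟩
  have e1 : u * (ainfToBdR Ainf_ + xiBdR ^ k * w₀) - x (N + r + j) =
      u * (ainfToBdR (Ainf_ - A (N + r + j)) + xiBdR ^ k * (w₀ - W (N + r + j))) := by
    have e2 : x (N + r + j) = u * ((p : BDeRhamPlus (integerC F) p) ^ r * x (N + r + j)) := by
      rw [← mul_assoc, mul_comm u, hu, one_mul]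
    rw [e2, hAW, map_sub]; ring
  rw [e1, ← he, mul_comm e]
  simp only [map_mul, map_pow, map_natCast]
  have e3 : (p : BDeRhamPlus (integerC F) p) ^ (N + r + j) = (p : BDeRhamPlus (integerC F) p) ^ r *
      ((p : BDeRhamPlus (integerC F) p) ^ N * (p : BDeRhamPlus (integerC F) p) ^ j) := by
    rw [← pow_add, ← pow_add]; congr 1; omega
  rw [e3]
  linear_combination (ainfToBdR e * ((p : BDeRhamPlus (integerC F) p) ^ N * (p : BDeRhamPlus (integerC F) p) ^ j)) * hu

/-- **Uniqueness of lattice limits modulo `Fil^k`**: two limits `L, L'` of the same sequence (each `L − x(M) ∈ Λ(N,k)` for `M`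
large) differ by an element of `ξ^k B_dR⁺` (`⋂_N Λ(N, k) = ξ^k B_dR⁺`). [cite: FontaineAsterisque223III, Exp. II §1.5.3] -/
theorem sub_mem_span_xiBdR_pow_of_forall_lattice_lim {x : ℕ → BDeRhamPlus (integerC F) p} {k : ℕ}
    {L L' : BDeRhamPlus (integerC F) p}
    (hL : ∀ N, ∃ M, ∃ (a : Ainf (p := p) F) (w : BDeRhamPlus (integerC F) p),
      L - x M = ainfToBdR ((p : Ainf (p := p) F) ^ N * a) + xiBdR ^ k * w ∧
      ∃ (a' : Ainf (p := p) F) (w' : BDeRhamPlus (integerC F) p),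
        L' - x M = ainfToBdR ((p : Ainf (p := p) F) ^ N * a') + xiBdR ^ k * w') :
    L - L' ∈ Ideal.span {(xiBdR : BDeRhamPlus (integerC F) p) ^ k} := by
  refine mem_span_xiBdR_pow_of_forall_lattice fun N => ?_
  obtain ⟨M, a, w, h, a', w', h'⟩ := hL N
  refine ⟨a - a', w - w', ?_⟩
  have e : L - L' = (L - x M) - (L' - x M) := by ring
  rw [e]
  exact lattice_sub h h'

end GaloisContinuity

end Literature.NumberTheory.PAdicHodge

end
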